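import Literature.Analysis.Complex.ArcGreenAsymptotics
import Literature.Analysis.Complex.HarmonicMaxPrinciple
import Literature.Topology.PlaneTopology.Janiszewski
import Mathlib.Analysis.InnerProductSpace.Harmonic.Constructions
import HarnessLib

/-!
# The Green function of an arc in the upper half-plane: harmonicity and the reflected difference

For a Jordan arc `L ⊆ ℍ` (strictly inside the open upper half-plane) with Green function
`g = arcGreen e` of `ℂ ∖ L` (`ArcInversion`, `ArcGreenEstimates`, `ArcGreenAsymptotics`), the
**reflected difference**

  `q(w) = g(w̄) - g(w)`

is the natural comparison function for harmonic-measure estimates in `ℍ`: it is harmonic on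
`ℍ ∖ L`, continuous on `ℂ`, vanishes on `ℝ` and at `∞`, equals `g(w̄) ≥ 0` on `L`, and hence

* `arcGreen_conj_sub_nonneg` — **`q ≥ 0` on the closed upper half-plane** (minimum principle
  for harmonic functions, `harmonic_ge_of_frontier_of_cocompact`, on the connected open set
  `ℍ ∖ L`).

Supporting facts proved here: `isPreconnected_upperHalfPlane_diff` — `ℍ` minus a compact
`L ⊆ ℍ` with connected complement is connected (Janiszewski's theorem for `L` and the compact
connected set "large circle ∪ real diameter", which meet nowhere); harmonicity of `g` off `L`
and of `g ∘ conj` off `L̄` in Mathlib's sense (`AnalyticAt.harmonicAt_log_norm` for the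
zero-free holomorphic `Φ`, resp. `conj ∘ Φ ∘ conj`).
-/

noncomputable section

open Set Filter Metric Topology Function Complex Bornology InnerProductSpace
open Literature.Topology.PlaneTopology (janiszewski' JordanArcSeparation_holds)
open scoped unitInterval ComplexConjugate

namespace Literature.Analysis.Complex

/-! ### `ℍ` minus a compact non-separating set is connected -/

/-- **`ℍ ∖ L` is connected** for a compact `L ⊆ ℍ` whose complement `ℂ ∖ L` is connected:
Janiszewski's theorem (`janiszewski'`) for the compact sets `L` and `S_R ∪ [-R, R]` (a large
circle with its real diameter), which are disjoint; two points of `ℍ ∖ L` inside the circle are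
separated by neither, hence not by the union, and the relevant component of the complement of
the union is trapped in the open upper half-disc. [folklore] -/
theorem isPreconnected_upperHalfPlane_diff {L : Set ℂ} (hLc : IsCompact L)
    (hLH : ∀ z ∈ L, 0 < z.im) (hconn : IsPreconnected Lᶜ) :
    IsPreconnected ({z : ℂ | 0 < z.im} \ L) := by
  refine isPreconnected_of_forall_pair fun x hx y hy ↦ ?_
  -- a large radius
  obtain ⟨R₀, hR₀⟩ := hLc.isBounded.subset_ball 0
  set R : ℝ := max R₀ (max ‖x‖ ‖y‖) + 1 with hR
  have hRpos : 0 < R := by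
    have : 0 ≤ max R₀ (max ‖x‖ ‖y‖) := le_trans (norm_nonneg x) ((le_max_left _ _).trans (le_max_right _ _))
    rw [hR]; linarith
  have hLR : L ⊆ ball 0 R := hR₀.trans (ball_subset_ball (by rw [hR]; linarith [le_max_left R₀ (max ‖x‖ ‖y‖)]))
  have hxR : ‖x‖ < R := by rw [hR]; linarith [le_max_left ‖x‖ ‖y‖, le_max_right R₀ (max ‖x‖ ‖y‖)]
  have hyR : ‖y‖ < R := by rw [hR]; linarith [le_max_right ‖x‖ ‖y‖, le_max_right R₀ (max ‖x‖ ‖y‖)]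
  -- the compact connected set `B = S_R ∪ [-R, R]`
  set D : Set ℂ := (fun t : ℝ ↦ (t : ℂ)) '' Icc (-R) R with hD
  set B : Set ℂ := sphere (0 : ℂ) R ∪ D with hB
  have hDc : IsCompact D := isCompact_Icc.image continuous_ofReal
  have hBc : IsCompact B := (isCompact_sphere 0 R).union hDc
  have hRD : ((R : ℝ) : ℂ) ∈ D := ⟨R, ⟨by linarith, le_rfl⟩, rfl⟩
  have hRS : ((R : ℝ) : ℂ) ∈ sphere (0 : ℂ) R := by
    rw [mem_sphere_zero_iff_norm, Complex.norm_real, Real.norm_eq_abs, abs_of_pos hRpos]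
  have hBconn : IsPreconnected B :=
    IsPreconnected.union ((R : ℝ) : ℂ) hRS hRD
      (isPreconnected_sphere (by rw [Complex.rank_real_complex]; exact Cardinal.one_lt_two) 0 R)
      (isPreconnected_Icc.image _ continuous_ofReal.continuousOn)
  have hmemB : ∀ z : ℂ, z ∈ B ↔ ‖z‖ = R ∨ (z.im = 0 ∧ |z.re| ≤ R) := by
    intro z
    simp only [hB, hD, mem_union, mem_sphere_zero_iff_norm, mem_image, mem_Icc]
    constructor
    · rintro (h | ⟨t, ht, rfl⟩)
      · exact Or.inl h
      · exact Or.inr ⟨Complex.ofReal_im t, by rw [Complex.ofReal_re]; exact abs_le.2 ht⟩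
    · rintro (h | ⟨him, hre⟩)
      · exact Or.inl h
      · exact Or.inr ⟨z.re, abs_le.1 hre, Complex.ext (by simp) (by simp [him])⟩
  -- `L ∩ B = ∅`
  have hLB : L ∩ B = ∅ := by
    refine eq_empty_of_forall_notMem fun z ⟨hzL, hzB⟩ ↦ ?_
    rcases (hmemB z).1 hzB with h | ⟨him, -⟩
    · have := hLR hzL
      rw [mem_ball_zero_iff, h] at this
      exact lt_irrefl _ this
    · exact absurd him (ne_of_gt (hLH z hzL))
  have hinter : IsPreconnected (L ∩ B) := by rw [hLB]; exact isPreconnected_empty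
  -- neither `L` nor `B` separates `x` from `y`
  have hxH : 0 < x.im := hx.1
  have hyH : 0 < y.im := hy.1
  set Dplus : Set ℂ := ball (0 : ℂ) R ∩ {z : ℂ | 0 < z.im} with hDplus
  have hDplusB : Dplus ⊆ Bᶜ := by
    rintro z ⟨hz, hzim⟩ hzB
    rcases (hmemB z).1 hzB with h | ⟨him, -⟩
    · rw [mem_ball_zero_iff, h] at hz
      exact lt_irrefl _ hz
    · exact absurd him (ne_of_gt hzim)
  obtain ⟨S, hS, hSc, hxS, hyS⟩ := janiszewski' hLc hBc hinter
    ⟨Lᶜ, Subset.rfl, hconn, hx.2, hy.2⟩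
    ⟨Dplus, hDplusB, ((convex_ball (0 : ℂ) R).inter (convex_halfSpace_im_gt 0)).isPreconnected,
      ⟨mem_ball_zero_iff.2 hxR, hxH⟩, ⟨mem_ball_zero_iff.2 hyR, hyH⟩⟩
  -- `S` is trapped in the open upper half-disc
  set O₁ : Set ℂ := ball (0 : ℂ) R ∩ {z : ℂ | 0 < z.im} with hO₁
  set O₂ : Set ℂ := (ball (0 : ℂ) R ∩ {z : ℂ | z.im < 0}) ∪ (closedBall (0 : ℂ) R)ᶜ with hO₂
  have hO₁o : IsOpen O₁ := isOpen_ball.inter (isOpen_lt continuous_const Complex.continuous_im)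
  have hO₂o : IsOpen O₂ :=
    (isOpen_ball.inter (isOpen_lt Complex.continuous_im continuous_const)).union isClosed_closedBall.isOpen_compl
  have hcover : S ⊆ O₁ ∪ O₂ := fun z hz ↦ by
    have hzB : z ∉ B := fun h ↦ hS hz (Or.inr h)
    rw [hmemB, not_or, not_and, not_le] at hzB
    rcases lt_trichotomy ‖z‖ R with h | h | h
    · have hzball : z ∈ ball (0 : ℂ) R := mem_ball_zero_iff.2 h
      rcases lt_trichotomy z.im 0 with him | him | him
      · exact Or.inr (Or.inl ⟨hzball, him⟩)
      · exfalso
        have := hzB.2 him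
        have : |z.re| ≤ ‖z‖ := Complex.abs_re_le_norm z
        linarith
      · exact Or.inl ⟨hzball, him⟩
    · exact absurd h hzB.1
    · exact Or.inr (Or.inr fun h' ↦ by rw [mem_closedBall_zero_iff] at h'; linarith)
  have hdisj : Disjoint O₁ O₂ := by
    rw [Set.disjoint_left]
    rintro z ⟨hz1, hz2⟩ (⟨-, hz3⟩ | hz3)
    · exact absurd (show 0 < z.im from hz2) (not_lt.2 (le_of_lt hz3))
    · exact hz3 (ball_subset_closedBall hz1)
  have hSO₁ : S ⊆ O₁ := by
    rcases hSc.subset_or_subset hO₁o hO₂o hdisj hcover with h | h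
    · exact h
    · exfalso
      exact Set.disjoint_left.1 hdisj ⟨mem_ball_zero_iff.2 hxR, hxH⟩ (h hxS)
  exact ⟨S, fun z hz ↦ ⟨(hSO₁ hz).2, fun hzL ↦ hS hz (Or.inl hzL)⟩, hxS, hyS, hSc⟩

/-! ### Harmonicity of the Green function and of its reflection -/

variable {L : Set ℂ} (e : I ≃ₜ L)

/-- `Φ` is analytic off the arc. [folklore] -/
theorem analyticAt_arcGreenMap {w : ℂ} (hw : w ∉ L) : AnalyticAt ℂ (arcGreenMap e) w :=
  (differentiableOn_arcGreenMap e).analyticAt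
    ((isCompact_arc e).isClosed.isOpen_compl.mem_nhds hw)

/-- **The Green function is harmonic off the arc** (it is `-log ‖Φ‖`, `Φ` zero-free
holomorphic). [folklore] -/
theorem harmonicAt_arcGreen {w : ℂ} (hw : w ∉ L) : HarmonicAt (arcGreen e) w := by
  have hopen : IsOpen Lᶜ := (isCompact_arc e).isClosed.isOpen_compl
  have h1 : HarmonicAt (fun z ↦ Real.log ‖arcGreenMap e z‖) w :=
    (analyticAt_arcGreenMap e hw).harmonicAt_log_norm (norm_pos_iff.1 (norm_arcGreenMap_mem e hw).1)
  refine (harmonicAt_congr_nhds ?_).2 h1.neg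
  filter_upwards [hopen.mem_nhds hw] with z hz
  rw [arcGreen_of_notMem e hz]
  rfl

/-- `z ↦ conj (Φ (conj z))` is analytic at `w` when `conj w ∉ L`. [folklore] -/
theorem analyticAt_conj_arcGreenMap_conj {w : ℂ} (hw : conj w ∉ L) :
    AnalyticAt ℂ (fun z ↦ conj (arcGreenMap e (conj z))) w := by
  have hopen : IsOpen Lᶜ := (isCompact_arc e).isClosed.isOpen_compl
  have hopen' : IsOpen (conj ⁻¹' Lᶜ) := continuous_conj.isOpen_preimage _ hopen
  exact (differentiableOn_conj_conj hopen (differentiableOn_arcGreenMap e)).analyticAt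
    (hopen'.mem_nhds hw)

/-- **The reflected Green function `g ∘ conj` is harmonic off `L̄`.** [folklore] -/
theorem harmonicAt_arcGreen_conj {w : ℂ} (hw : conj w ∉ L) :
    HarmonicAt (fun z ↦ arcGreen e (conj z)) w := by
  have hopen : IsOpen Lᶜ := (isCompact_arc e).isClosed.isOpen_compl
  have hopen' : IsOpen (conj ⁻¹' Lᶜ) := continuous_conj.isOpen_preimage _ hopen
  have hne : conj (arcGreenMap e (conj w)) ≠ 0 := by
    rw [map_ne_zero]
    exact norm_pos_iff.1 (norm_arcGreenMap_mem e hw).1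
  have h1 : HarmonicAt (fun z ↦ Real.log ‖conj (arcGreenMap e (conj z))‖) w :=
    (analyticAt_conj_arcGreenMap_conj e hw).harmonicAt_log_norm hne
  refine (harmonicAt_congr_nhds ?_).2 h1.neg
  filter_upwards [hopen'.mem_nhds hw] with z hz
  rw [arcGreen_of_notMem e hz, Pi.neg_apply, Complex.norm_conj]

/-- The reflected difference `q = g ∘ conj - g` is continuous on `ℂ`. [folklore] -/
theorem continuous_arcGreen_conj_sub : Continuous fun w ↦ arcGreen e (conj w) - arcGreen e w :=
  ((continuous_arcGreen e).comp continuous_conj).sub (continuous_arcGreen e)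

/-- The reflected difference vanishes on the real axis. [folklore] -/
theorem arcGreen_conj_sub_of_im_eq_zero {w : ℂ} (hw : w.im = 0) :
    arcGreen e (conj w) - arcGreen e w = 0 := by
  rw [Complex.conj_eq_iff_im.2 hw, sub_self]

/-! ### `q ≥ 0` on the closed upper half-plane -/

/-- **The reflected difference of the Green function is nonnegative on the closed upper
half-plane** when the arc lies in the open upper half-plane: `g(w̄) ≥ g(w)` for `im w ≥ 0`.
Minimum principle on the connected open set `ℍ ∖ L`, where `q = g ∘ conj - g` is harmonic,
with boundary values `0` on `ℝ`, `g(w̄) ≥ 0` on `L`, and `q → 0` at `∞`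
(`tendsto_arcGreen_conj_sub`). [folklore] -/
theorem arcGreen_conj_sub_nonneg (hLH : ∀ z ∈ L, 0 < z.im) {w : ℂ} (hw : 0 ≤ w.im) :
    0 ≤ arcGreen e (conj w) - arcGreen e w := by
  rcases hw.eq_or_lt with him | him
  · rw [arcGreen_conj_sub_of_im_eq_zero e him.symm]
  by_cases hwL : w ∈ L
  · rw [arcGreen_of_mem e hwL, sub_zero]
    exact arcGreen_nonneg e _
  -- the minimum principle on `U = ℍ ∖ L`
  set U : Set ℂ := {z : ℂ | 0 < z.im} \ L with hU
  set q : ℂ → ℝ := fun z ↦ arcGreen e (conj z) - arcGreen e z with hq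
  have hLc : IsCompact L := isCompact_arc e
  have hUo : IsOpen U := (isOpen_lt continuous_const Complex.continuous_im).sdiff hLc.isClosed
  have hUc : IsPreconnected U :=
    isPreconnected_upperHalfPlane_diff hLc hLH (JordanArcSeparation_holds L ⟨e⟩).isPreconnected
  have hconjL : ∀ z : ℂ, 0 ≤ z.im → conj z ∉ L := fun z hz h ↦ by
    have := hLH _ h
    rw [Complex.conj_im] at this
    linarith
  have hharm : HarmonicOnNhd q U := fun z hz ↦
    (harmonicAt_arcGreen_conj e (hconjL z hz.1.le)).sub (harmonicAt_arcGreen e hz.2)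
  have hqc : Continuous q := continuous_arcGreen_conj_sub e
  -- boundary values `≥ 0`
  have hfront : ∀ ζ ∈ frontier U, 0 ≤ q ζ := by
    intro ζ hζ
    have hζ' : ζ.im = 0 ∨ ζ ∈ L := by
      rw [hU, Set.sdiff_eq] at hζ
      have h := frontier_inter_subset _ _ hζ
      rw [Complex.frontier_setOf_lt_im, frontier_compl] at h
      rcases h with ⟨h, -⟩ | ⟨-, h⟩
      · exact Or.inl h
      · exact Or.inr (hLc.isClosed.frontier_subset h)
    rcases hζ' with h | h
    · rw [hq]; dsimp only; rw [arcGreen_conj_sub_of_im_eq_zero e h]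
    · rw [hq]; dsimp only
      rw [arcGreen_of_mem e h, sub_zero]
      exact arcGreen_nonneg e _
  have hbdry : ∀ ζ ∈ frontier U, ∀ ε : ℝ, 0 < ε → ∀ᶠ z in 𝓝[U] ζ, 0 - ε ≤ q z := by
    intro ζ hζ ε hε
    have h1 : ∀ᶠ z in 𝓝 ζ, q ζ - ε < q z := by
      have := hqc.continuousAt (x := ζ)
      exact this.eventually (Ioi_mem_nhds (by linarith))
    refine (h1.filter_mono nhdsWithin_le_nhds).mono fun z hz ↦ ?_
    linarith [hfront ζ hζ]
  have hinf : ∀ ε : ℝ, 0 < ε → ∀ᶠ z in cocompact ℂ ⊓ 𝓟 U, 0 - ε ≤ q z := by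
    intro ε hε
    have h1 := tendsto_arcGreen_conj_sub e
    rw [cobounded_eq_cocompact, Metric.tendsto_nhds] at h1
    refine ((h1 ε hε).filter_mono inf_le_left).mono fun z hz ↦ ?_
    rw [dist_zero_right, Real.norm_eq_abs, abs_lt] at hz
    rw [hq]; dsimp only
    linarith [hz.1]
  have h := harmonic_ge_of_frontier_of_cocompact hUo hUc hharm hbdry hinf w ⟨him, hwL⟩
  exact h

end Literature.Analysis.Complex
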